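import Mathlib.Algebra.Polynomial.Derivative
import Literature.NumberTheory.EllipticCurves.IsogenyFromRationalMap

/-!
# `AlgebraicModuliRealPeriodCell` (stmt-KontsevichZagierPeriods-18265, route IsogenyCertificates) —
line `Sketch`, stub **V**, auxiliary file: datum algebra over an arbitrary field

First half of the port of the `ℚ`-line's orbit collapse
(`Theorems/IsogenyCertificatesXMapKernelStubOrbitCollapse.lean`, §§2–3, and
`Theorems/EffectiveXMapChains/Negative/LimitValue.lean`) from `ℚ` to an ARBITRARY field `F` (it is
used over `F = ℚ̄ ∩ ℝ` by `IsogenyCertificatesAlgebraicModuliRealPeriodCellStubOrbitRatio.lean`).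
A *datum* from `(α, β)` to `(α', β')` is `(f, g, c)`, `f g : F[X]`, `c : F`, with
`W := f'g − fg' ≠ 0` and `c²·g·(f³ + α'fg² + β'g³) = (X³ + αX + β)·W²`.

* `limit_value_is_root` — if `deg f ≤ deg g` then `R(∞) = fₙ/gₙ` is a root of `x³ + α'x + β'`;
* `exists_datum_natDegree_lt` — normalisation to `deg g < deg f` by the `2`-torsion translation
  `X ↦ (eX + 2e² + α')/(X − e)`, `e = R(∞)` (for nonsingular `(α', β')`);
* `nonempty_isogenyFormula` — a datum with `deg g < deg f` is a tree
  `WeierstrassCurve.IsogenyFormula ⟨0,0,0,α,β⟩ ⟨0,0,0,α',β'⟩` (`U = fg`, `h = g`, `S = c⁻¹Wg`,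
  `T = 0`);
* `datum_of_map` — a datum descends along a field embedding `F → L`;
* `stub_algDatumNormalForm` — the registered sub-goal (= `exists_datum_natDegree_lt`, explicit
  form).

References: Silverman, *The Arithmetic of Elliptic Curves* (2009), Thm. III.4.8, Remark III.4.13.2.
-/

noncomputable section

namespace Summit.KontsevichZagierPeriods.IsogenyCertificates.AlgRealPeriodCell.OrbitRatio

open Polynomial

/-! ## §1 Datum algebra over an arbitrary field -/

section Generic

variable {F : Type*} [Field F] {α β α' β' c : F} {f g : F[X]}

/-- **Forced non-degeneracy** of a datum over a field: `g ≠ 0` (else `W = 0`) and `c ≠ 0` (else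
`P·W² = 0` with `P` monic). [folklore] -/
theorem g_ne_zero_and_c_ne_zero (hW : derivative f * g - f * derivative g ≠ 0)
    (hI : C (c ^ 2) * g * (f ^ 3 + C α' * f * g ^ 2 + C β' * g ^ 3) =
      (X ^ 3 + C α * X + C β) * (derivative f * g - f * derivative g) ^ 2) :
    g ≠ 0 ∧ c ≠ 0 := by
  refine ⟨?_, ?_⟩
  · rintro rfl; exact hW (by simp)
  · rintro rfl
    have hm : (X ^ 3 + (C α * X + C β) : F[X]).Monic :=
      monic_X_pow_add (degree_linear_le.trans_lt (by norm_num))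
    rw [← add_assoc] at hm
    simp only [ne_eq, OfNat.ofNat_ne_zero, not_false_eq_true, zero_pow, map_zero, zero_mul] at hI
    exact (mul_ne_zero hm.ne_zero (pow_ne_zero 2 hW)) hI.symm

/-- **`R(∞)` is a 2-torsion abscissa of the target** (port of the `ℚ`-line's
`EffectiveXMapChainsNegative.limit_value_is_root` to an arbitrary field). For a datum `(f, g, c)`
with `deg f ≤ deg g = n`, the finite limit `L = fₙ/gₙ` of `R = f/g` at `∞` satisfies
`L³ + α'L + β' = 0`: compare the coefficients of `X^{4n}` in `c²·g·(f³ + α'fg² + β'g³) = P·W²`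
(`deg W ≤ 2n − 2`). [cite: SilvermanAEC2009, III.4 (Remark 4.13.2)] -/
theorem limit_value_is_root (hW : derivative f * g - f * derivative g ≠ 0)
    (hI : C (c ^ 2) * g * (f ^ 3 + C α' * f * g ^ 2 + C β' * g ^ 3) =
      (X ^ 3 + C α * X + C β) * (derivative f * g - f * derivative g) ^ 2)
    (hc : c ≠ 0) (hfg : f.natDegree ≤ g.natDegree) :
    (f.coeff g.natDegree / g.leadingCoeff) ^ 3 + α' * (f.coeff g.natDegree / g.leadingCoeff)
      + β' = 0 := by
  -- adapted from `EffectiveXMapChainsNegative.limit_value_is_root` (ℚ ↦ any field)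
  set n := g.natDegree with hn'
  have hg0 : g ≠ 0 := by rintro rfl; exact hW (by simp)
  have hgc : g.leadingCoeff ≠ 0 := leadingCoeff_ne_zero.mpr hg0
  have hn : 1 ≤ n := by
    by_contra h0
    have hn0 : n = 0 := by omega
    have hf0 : f.natDegree = 0 := by omega
    apply hW
    rw [eq_C_of_natDegree_eq_zero hn0, eq_C_of_natDegree_eq_zero hf0]
    simp
  -- the Wronskian drops two degrees: `deg W ≤ 2n - 2`
  have hWdeg : (derivative f * g - f * derivative g).natDegree ≤ 2 * n - 2 := by
    have hf' : (derivative f).natDegree ≤ n - 1 :=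
      (natDegree_derivative_le f).trans (Nat.sub_le_sub_right hfg 1)
    have hg' : (derivative g).natDegree ≤ n - 1 := natDegree_derivative_le g
    have h1 : (derivative f * g).natDegree ≤ n - 1 + n := natDegree_mul_le_of_le hf' le_rfl
    have h2 : (f * derivative g).natDegree ≤ n + (n - 1) := natDegree_mul_le_of_le hfg hg'
    have htop : (derivative f * g - f * derivative g).coeff (n - 1 + n) = 0 := by
      rw [coeff_sub, coeff_mul_add_eq_of_natDegree_le hf' le_rfl,
        show n - 1 + n = n + (n - 1) by omega, coeff_mul_add_eq_of_natDegree_le hfg hg',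
        coeff_derivative, coeff_derivative, show n - 1 + 1 = n by omega]
      ring
    have hle : (derivative f * g - f * derivative g).natDegree ≤ n - 1 + n :=
      (natDegree_sub_le _ _).trans (max_le h1 (by simpa [add_comm] using h2))
    rw [natDegree_le_iff_coeff_eq_zero] at hle ⊢
    intro j hj
    rcases lt_or_eq_of_le (show n - 1 + n ≤ j by omega) with h | h
    · exact hle j (by exact_mod_cast h)
    · rw [← h]; exact htop
  -- the coefficient of `X^{4n}` on the right vanishes
  have hR : ((X ^ 3 + C α * X + C β) *
      (derivative f * g - f * derivative g) ^ 2).coeff (4 * n) = 0 := by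
    apply coeff_eq_zero_of_natDegree_lt
    have hP : (X ^ 3 + C α * X + C β : F[X]).natDegree ≤ 3 := by
      refine (natDegree_add_le _ _).trans (max_le ((natDegree_add_le _ _).trans (max_le ?_ ?_)) ?_)
      · simp
      · exact (natDegree_C_mul_le _ _).trans (by simp)
      · simp
    have hW2 : ((derivative f * g - f * derivative g) ^ 2).natDegree ≤ 2 * (2 * n - 2) :=
      natDegree_pow_le_of_le 2 hWdeg
    have := natDegree_mul_le_of_le hP hW2
    omega
  -- the coefficient of `X^{4n}` on the left is `c² gₙ (fₙ³ + α' fₙ gₙ² + β' gₙ³)`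
  have hQ : (f ^ 3 + C α' * f * g ^ 2 + C β' * g ^ 3).natDegree ≤ 3 * n := by
    refine (natDegree_add_le _ _).trans (max_le ((natDegree_add_le _ _).trans (max_le ?_ ?_)) ?_)
    · exact natDegree_pow_le_of_le 3 hfg |>.trans (by omega)
    · calc (C α' * f * g ^ 2).natDegree ≤ (C α' * f).natDegree + (g ^ 2).natDegree :=
            natDegree_mul_le
        _ ≤ n + 2 * n :=
            add_le_add ((natDegree_C_mul_le _ _).trans hfg) (natDegree_pow_le_of_le 2 le_rfl)
        _ = 3 * n := by ring
    · exact (natDegree_C_mul_le _ _).trans (natDegree_pow_le_of_le 3 le_rfl |>.trans (by omega))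
  have hQc : (f ^ 3 + C α' * f * g ^ 2 + C β' * g ^ 3).coeff (3 * n) =
      f.coeff n ^ 3 + α' * f.coeff n * g.coeff n ^ 2 + β' * g.coeff n ^ 3 := by
    rw [coeff_add, coeff_add, coeff_pow_of_natDegree_le hfg, mul_assoc, coeff_C_mul,
      show 3 * n = n + 2 * n by ring,
      coeff_mul_add_eq_of_natDegree_le hfg (natDegree_pow_le_of_le 2 le_rfl),
      coeff_pow_of_natDegree_le le_rfl, coeff_C_mul, show n + 2 * n = 3 * n by ring,
      coeff_pow_of_natDegree_le le_rfl]
    ring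
  have hL : (C (c ^ 2) * g * (f ^ 3 + C α' * f * g ^ 2 + C β' * g ^ 3)).coeff (4 * n) =
      c ^ 2 * (g.coeff n * (f.coeff n ^ 3 + α' * f.coeff n * g.coeff n ^ 2 +
        β' * g.coeff n ^ 3)) := by
    rw [mul_assoc, coeff_C_mul, show 4 * n = n + 3 * n by ring,
      coeff_mul_add_eq_of_natDegree_le le_rfl hQ, hQc]
  have key : c ^ 2 * (g.coeff n * (f.coeff n ^ 3 + α' * f.coeff n * g.coeff n ^ 2 +
      β' * g.coeff n ^ 3)) = 0 := by
    rw [← hL, hI, hR]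
  have hgn : g.coeff n = g.leadingCoeff := rfl
  rw [hgn] at key
  have key' :
      f.coeff n ^ 3 + α' * f.coeff n * g.leadingCoeff ^ 2 + β' * g.leadingCoeff ^ 3 = 0 := by
    rcases mul_eq_zero.mp key with h | h
    · exact absurd h (pow_ne_zero 2 hc)
    · rcases mul_eq_zero.mp h with h | h
      · exact absurd h hgc
      · exact h
  field_simp
  linear_combination key'

/-- A simple root `e` of `x³ + α'x + β'`: `4α'³ + 27β'² ≠ 0` and `e³ + α'e + β' = 0` force
`3e² + α' ≠ 0` (the discriminant lies in the ideal `(Q(e), Q'(e))`). [folklore] -/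
theorem three_mul_sq_add_ne_zero {e : F} (hΔ' : 4 * α' ^ 3 + 27 * β' ^ 2 ≠ 0)
    (he : e ^ 3 + α' * e + β' = 0) : 3 * e ^ 2 + α' ≠ 0 := by
  intro h3
  apply hΔ'
  linear_combination (-(18 * α' * e - 27 * β')) * he +
    (4 * α' ^ 2 + 6 * α' * e ^ 2 - 9 * β' * e) * h3

/-- **Normalisation of the datum** (any field). Every datum `(f, g, c)` from `(α, β)` to a
nonsingular `(α', β')` can be replaced by one with `deg g < deg f` over the SAME field: if
`deg f ≤ deg g`, `e = R(∞) ∈ F` is a simple root of `x³ + α'x + β'` (`limit_value_is_root`), and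
composing with the translation `X ↦ (eX + 2e² + α')/(X − e)` by the `2`-torsion point `(e, 0)` of
the target yields the datum `(ef + (2e² + α')g, f − eg, c)` with Wronskian `−(3e² + α')·W ≠ 0` and
`deg (f − eg) < deg g = deg (ef + (2e² + α')g)`. [cite: SilvermanAEC2009, III.4 (Remark 4.13.2)] -/
theorem exists_datum_natDegree_lt (hΔ' : 4 * α' ^ 3 + 27 * β' ^ 2 ≠ 0)
    (hW : derivative f * g - f * derivative g ≠ 0)
    (hI : C (c ^ 2) * g * (f ^ 3 + C α' * f * g ^ 2 + C β' * g ^ 3) =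
      (X ^ 3 + C α * X + C β) * (derivative f * g - f * derivative g) ^ 2) :
    ∃ (f₂ g₂ : F[X]) (c₂ : F), derivative f₂ * g₂ - f₂ * derivative g₂ ≠ 0 ∧
      C (c₂ ^ 2) * g₂ * (f₂ ^ 3 + C α' * f₂ * g₂ ^ 2 + C β' * g₂ ^ 3) =
        (X ^ 3 + C α * X + C β) * (derivative f₂ * g₂ - f₂ * derivative g₂) ^ 2 ∧
      g₂.natDegree < f₂.natDegree := by
  -- adapted from `XMapKernelStubs.OrbitCollapse.exists_datum_natDegree_lt` (ℚ ↦ any field)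
  rcases lt_or_ge g.natDegree f.natDegree with hlt | hle
  · exact ⟨f, g, c, hW, hI, hlt⟩
  obtain ⟨hg, hc⟩ := g_ne_zero_and_c_ne_zero hW hI
  have hgc : g.leadingCoeff ≠ 0 := leadingCoeff_ne_zero.mpr hg
  -- the finite value `e = R(∞)`, a simple root of the target cubic in `F`
  set n := g.natDegree with hn
  set e : F := f.coeff n / g.leadingCoeff with he_def
  have he : e ^ 3 + α' * e + β' = 0 := limit_value_is_root hW hI hc hle
  have h3 : 3 * e ^ 2 + α' ≠ 0 := three_mul_sq_add_ne_zero hΔ' he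
  have hfn : f.coeff n = e * g.leadingCoeff := by rw [he_def, div_mul_cancel₀ _ hgc]
  have hC2 : (C (2 * e ^ 2 + α') : F[X]) = 2 * C e ^ 2 + C α' := by
    simp only [map_add, map_mul, map_pow, map_ofNat]
  have hC3 : (C (3 * e ^ 2 + α') : F[X]) = 3 * C e ^ 2 + C α' := by
    simp only [map_add, map_mul, map_pow, map_ofNat]
  have hC3ne : (C (3 * e ^ 2 + α') : F[X]) ≠ 0 := by
    rwa [Ne, C_eq_zero]
  have hroot : (C β' : F[X]) + C e ^ 3 + C α' * C e = 0 := by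
    have h0 : (C (e ^ 3 + α' * e + β') : F[X]) = 0 := by rw [he, map_zero]
    rw [map_add, map_add, map_mul, map_pow] at h0
    linear_combination h0
  -- the translated datum and its Wronskian
  have hWeq : derivative (C e * f + C (2 * e ^ 2 + α') * g) * (f - C e * g) -
      (C e * f + C (2 * e ^ 2 + α') * g) * derivative (f - C e * g) =
      -C (3 * e ^ 2 + α') * (derivative f * g - f * derivative g) := by
    simp only [derivative_add, derivative_sub, derivative_C_mul]
    rw [hC2, hC3]
    ring
  have hW₂ : derivative (C e * f + C (2 * e ^ 2 + α') * g) * (f - C e * g) -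
      (C e * f + C (2 * e ^ 2 + α') * g) * derivative (f - C e * g) ≠ 0 := by
    rw [hWeq]
    exact mul_ne_zero (neg_ne_zero.mpr hC3ne) hW
  refine ⟨C e * f + C (2 * e ^ 2 + α') * g, f - C e * g, c, hW₂, ?_, ?_⟩
  · -- the datum identity of the translate: a polynomial identity modulo `e³ + α'e + β' = 0`
    rw [hWeq, hC2, hC3]
    linear_combination (3 * C e ^ 2 + C α') ^ 2 * hI +
      C (c ^ 2) * ((f - C e * g) ^ 4 - (3 * C e ^ 2 + C α') ^ 2 * g ^ 4) * hroot
  · -- degrees: `deg (f − e g) < n ≤ deg (e f + (2e² + α') g)`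
    have hg₂ : f - C e * g ≠ 0 := by
      intro h0
      apply hW₂
      rw [h0, derivative_zero, mul_zero, mul_zero, sub_self]
    have hlt : (f - C e * g).natDegree < n := by
      rw [natDegree_lt_iff_degree_lt hg₂, degree_lt_iff_coeff_zero]
      intro m hm
      rw [coeff_sub, coeff_C_mul]
      rcases hm.eq_or_lt with hmn | hmn
      · rw [← hmn, hfn]
        change e * g.leadingCoeff - e * g.coeff g.natDegree = 0
        rw [Polynomial.leadingCoeff, sub_self]
      · rw [coeff_eq_zero_of_natDegree_lt (hle.trans_lt hmn), coeff_eq_zero_of_natDegree_lt hmn]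
        ring
    have hge : n ≤ (C e * f + C (2 * e ^ 2 + α') * g).natDegree := by
      apply le_natDegree_of_ne_zero
      rw [coeff_add, coeff_C_mul, coeff_C_mul, hfn]
      change e * (e * g.leadingCoeff) + (2 * e ^ 2 + α') * g.leadingCoeff ≠ 0
      have : e * (e * g.leadingCoeff) + (2 * e ^ 2 + α') * g.leadingCoeff =
          (3 * e ^ 2 + α') * g.leadingCoeff := by ring
      rw [this]
      exact mul_ne_zero h3 hgc
    exact hlt.trans_le hge

/-- **The isogeny formula of a datum** (any field). For a datum `(f, g, c)` from `(α, β)` to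
`(α', β')` with `deg g < deg f`, the data `U = fg`, `h = g`, `S = c⁻¹·W·g`, `T = 0` form a tree
`WeierstrassCurve.IsogenyFormula` `y² = x³ + αx + β → y² = x³ + α'x + β'`
(`x ↦ f/g = U/h²`, `y ↦ y·W/(c g²) = S y/h³`; `identity₀` is the datum identity times `g²/c²`,
`identity₁` is `0 = 0` as `a₁ = a₃ = 0`, and `deg h² = 2 deg g < deg f + deg g = deg U`).
[cite: SilvermanAEC2009, Thm. III.4.8 (PDF pp. 70–71)] -/
theorem nonempty_isogenyFormula (hW : derivative f * g - f * derivative g ≠ 0)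
    (hI : C (c ^ 2) * g * (f ^ 3 + C α' * f * g ^ 2 + C β' * g ^ 3) =
      (X ^ 3 + C α * X + C β) * (derivative f * g - f * derivative g) ^ 2)
    (hdeg : g.natDegree < f.natDegree) :
    Nonempty (WeierstrassCurve.IsogenyFormula (⟨0, 0, 0, α, β⟩ : WeierstrassCurve F)
      (⟨0, 0, 0, α', β'⟩ : WeierstrassCurve F)) := by
  -- adapted from `XMapKernelStubs.OrbitCollapse.nonempty_isogenyFormula` (ℚ ↦ any field)
  obtain ⟨hg, hc⟩ := g_ne_zero_and_c_ne_zero hW hI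
  have hf : f ≠ 0 := by
    rintro rfl
    simp at hW
  have hc1 : (C c⁻¹ : F[X]) ^ 2 * C (c ^ 2) = 1 := by
    rw [← C_pow, ← C_mul, inv_pow, inv_mul_cancel₀ (pow_ne_zero 2 hc), C_1]
  -- fields: `U`, `h`, `S`, `T`, `identity₁`, `identity₀`, `h_ne_zero`, `natDegree_lt`
  refine ⟨⟨f * g, g, C c⁻¹ * (derivative f * g - f * derivative g) * g, 0, ?_, ?_, hg, ?_⟩⟩
  · simp only [map_zero, zero_mul, mul_zero, add_zero]
  · simp only [map_zero, zero_mul, mul_zero, add_zero]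
    linear_combination (-(C c⁻¹) ^ 2 * g ^ 2) * hI +
      (g ^ 3 * (f ^ 3 + C α' * f * g ^ 2 + C β' * g ^ 3)) * hc1
  · rw [natDegree_pow, natDegree_mul hf hg]
    omega

/-- **Descent of a datum along a field embedding.** If `(f, g, c)` over `F`, pushed forward along
an embedding `φ : F → L`, is a datum from `(φα, φβ)` to `(φα', φβ')` over `L`, then `(f, g, c)` is
a datum from `(α, β)` to `(α', β')` over `F` (`Polynomial.map φ` is an injective ring map commuting
with `derivative`). [folklore] -/
theorem datum_of_map {L : Type*} [Field L] (φ : F →+* L)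
    (hW : derivative (f.map φ) * g.map φ - f.map φ * derivative (g.map φ) ≠ 0)
    (hI : C (φ c ^ 2) * g.map φ *
        ((f.map φ) ^ 3 + C (φ α') * f.map φ * (g.map φ) ^ 2 + C (φ β') * (g.map φ) ^ 3) =
      (X ^ 3 + C (φ α) * X + C (φ β)) *
        (derivative (f.map φ) * g.map φ - f.map φ * derivative (g.map φ)) ^ 2) :
    derivative f * g - f * derivative g ≠ 0 ∧
      C (c ^ 2) * g * (f ^ 3 + C α' * f * g ^ 2 + C β' * g ^ 3) =
        (X ^ 3 + C α * X + C β) * (derivative f * g - f * derivative g) ^ 2 := by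
  have eW : derivative (f.map φ) * g.map φ - f.map φ * derivative (g.map φ) =
      (derivative f * g - f * derivative g).map φ := by
    rw [derivative_map, derivative_map, Polynomial.map_sub, Polynomial.map_mul, Polynomial.map_mul]
  rw [eW] at hW hI
  refine ⟨fun h0 => hW (by rw [h0, Polynomial.map_zero]),
    Polynomial.map_injective φ φ.injective ?_⟩
  simpa only [Polynomial.map_mul, Polynomial.map_add, Polynomial.map_pow, map_C, map_X, map_pow]
    using hI

end Generic

/-! ## §2 The registered sub-goal: normal form of a datum -/

/-- **Sub-stub of V — normal form of a datum** (registered sub-goal `stub_algDatumNormalForm` of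
stmt-KontsevichZagierPeriods-18265): over any field, a datum from `(α, β)` to a nonsingular
`(α', β')` can be replaced by one with `deg g < deg f` (`exists_datum_natDegree_lt`).
[cite: SilvermanAEC2009, III.4 (Remark 4.13.2)] -/
theorem stub_algDatumNormalForm : ∀ (F : Type) [Field F] (α β α' β' c : F) (f g : Polynomial F), 4 * α' ^ 3 + 27 * β' ^ 2 ≠ 0 → Polynomial.derivative f * g - f * Polynomial.derivative g ≠ 0 → Polynomial.C (c ^ 2) * g * (f ^ 3 + Polynomial.C α' * f * g ^ 2 + Polynomial.C β' * g ^ 3) = (Polynomial.X ^ 3 + Polynomial.C α * Polynomial.X + Polynomial.C β) * (Polynomial.derivative f * g - f * Polynomial.derivative g) ^ 2 → ∃ (f₂ g₂ : Polynomial F) (c₂ : F), Polynomial.derivative f₂ * g₂ - f₂ * Polynomial.derivative g₂ ≠ 0 ∧ Polynomial.C (c₂ ^ 2) * g₂ * (f₂ ^ 3 + Polynomial.C α' * f₂ * g₂ ^ 2 + Polynomial.C β' * g₂ ^ 3) = (Polynomial.X ^ 3 + Polynomial.C α * Polynomial.X + Polynomial.C β) * (Polynomial.derivative f₂ * g₂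 - f₂ * Polynomial.derivative g₂) ^ 2 ∧ g₂.natDegree < f₂.natDegree :=
  fun _ _ _ _ _ _ _ _ _ hΔ' hW hI => exists_datum_natDegree_lt hΔ' hW hI

end Summit.KontsevichZagierPeriods.IsogenyCertificates.AlgRealPeriodCell.OrbitRatio

end
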